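import Mathlib
import Summits.CriticalPhenomena.SAWScalingLimit.Theorems.SAWDefectDecoherenceDefectDecoherenceTmRenewal
import Literature.Probability.LatticeModels.TriangularLatticeProofs
import Literature.Probability.RandomPlanarGeometry.HexDomainSingleton
import Literature.Probability.RandomPlanarGeometry.HexSAW
import HarnessLib

/-!
# Renewal of the defect and mass star sums; the `ℤ/3` rotation about `c_v`
(helper `tm_defect_renewal` for the stub `stub_telescopingRecursion` of the line
`tip-martingale-depth-induction`, crux `DefectDecoherence`, stmt-CriticalPhenomena-8549)

* Along a first-entrance split the WINDINGS ADD and the WEIGHTS MULTIPLY (`lw_append`: the last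
  half-segment of the prefix and the first half-segment of the continuation are halves of the edge
  `{y,z}`), so the restricted star sums `TC` (defect type, `e^{-5iW/8} x_c^ℓ`, coefficients
  `conj(mid{v,t} - c_v)`) and `TR` (mass type, `x_c^ℓ`) re-sum over prefixes
  (`star_sum_renewal`, `TC_renewal`, `TR_renewal`); in particular the line's identities
  `T(Λ,u,w,v) = prefixSumC (w(π) · T(Λ ∖ π, y, z, v))` (`tm_defect_renewal`, registered) and
  `M(Λ,u,w,v) = prefixSumR (x_c^{|π|} · M(Λ ∖ π, y, z, v))` (`tm_mass_renewal`).
* `rot3 v` (Defs) is the rotation by `+120°` about `c_v`: `c(rot3 v y) - c_v = ζ²(c_y - c_v)`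
  (`hexCenter_rot3_sub`), it has order `3`, fixes `v`, preserves distances to `c_v` and is an
  automorphism of `hexGraph` (`rot3_adj_iff`, `rot3Iso`).

Sources: H. Duminil-Copin, S. Smirnov, *The connective constant of the honeycomb lattice equals
`√(2+√2)`*, Ann. of Math. 175 (2012) (arXiv:1007.0575), §1–§2 (walks between mid-edges, windings,
Definition 1); the line card `Lines/tip-martingale-depth-induction.md` of the crux.
Deliberately NOT here: transport of walks under `rot3` (file `…TmAdmissible`).
-/

noncomputable section

open scoped BigOperators ComplexConjugate Classical
open Literature.Probability.LatticeModels Literature.Probability.RandomPlanarGeometry.SAW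

namespace Summit.CriticalPhenomena.SAWScalingLimit.Theorems.DefectDecoherence.TipMartingale

/-! ### Lattice distances -/

/-- Adjacent vertices of `ℍ` have centres at squared distance `1/3`. [folklore] -/
theorem normSq_hexCenter_sub_of_adj {x y : HexVertex} (h : hexGraph.Adj x y) :
    Complex.normSq (hexCenter x - hexCenter y) = 1 / 3 := by
  obtain ⟨p, k⟩ := x
  obtain ⟨q, l⟩ := y
  rw [hexCenter_sub_hexCenter, normSq_add_mul_triZeta]
  fin_cases k <;> fin_cases l
  · exact absurd h (not_hexGraph_adj_of_snd_eq_holds _ _ rfl)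
  · rcases (hexGraph_adj_iff_of_snd_eq_zero_holds p q).1 h with rfl | rfl | rfl <;>
      simp [Pi.sub_apply] <;> ring
  · rcases (hexGraph_adj_iff_of_snd_eq_one p q).1 h with rfl | rfl | rfl <;>
      simp [Pi.add_apply] <;> ring
  · exact absurd h (not_hexGraph_adj_of_snd_eq_holds _ _ rfl)

/-- Adjacent vertices of `ℍ` are at distance `1/√3`. [folklore] -/
theorem dist_hexCenter_of_adj {x y : HexVertex} (h : hexGraph.Adj x y) :
    dist (hexCenter x) (hexCenter y) = (Real.sqrt 3)⁻¹ := by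
  rw [Complex.dist_eq, ← Real.sqrt_sq (norm_nonneg _), Complex.sq_norm,
    normSq_hexCenter_sub_of_adj h, one_div, Real.sqrt_inv]

/-- Adjacent vertices of `ℍ` are at distance `≤ 1`. [folklore] -/
theorem dist_hexCenter_le_one_of_adj {x y : HexVertex} (h : hexGraph.Adj x y) :
    dist (hexCenter x) (hexCenter y) ≤ 1 := by
  rw [dist_hexCenter_of_adj h]
  exact inv_le_one_of_one_le₀ (Real.one_le_sqrt.2 (by norm_num))

/-- `0 < x_c`. [folklore] -/
theorem xc_pos : 0 < xc := hexCriticalFugacity_pos_lt_one.1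

/-! ### Weights multiply, and the star sums re-sum over prefixes -/

section StarSums

variable {D : Finset HexVertex} {a b : Sym2 HexVertex} {u w v : HexVertex} {ρ : ℝ}

/-- The weight `e^{-iσW} x_c^ℓ` of a walk as a function of its vertex list. [folklore] -/
def lw (a b : Sym2 HexVertex) (σ : ℝ) (l : List HexVertex) : ℂ :=
  Complex.exp (-Complex.I * σ * (Literature.Probability.LatticeModels.winding
    (hexMidpoint a :: l.map hexCenter ++ [hexMidpoint b]) : ℝ)) * (xc : ℂ) ^ l.length

/-- `γ.weight x_c σ = lw a b σ γ.verts`. [folklore] -/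
theorem weight_eq_lw (γ : HexMidEdgeSAW D a b) (σ : ℝ) : γ.weight xc σ = lw a b σ γ.verts := rfl

/-- **Windings add, weights multiply** along a first-entrance split: the last half-segment of
the prefix and the first half-segment of the continuation are halves of the edge `{y, z}`, so no
turning is lost or created at the junction. [folklore] -/
theorem lw_append (a b : Sym2 HexVertex) (σ : ℝ) (y z : HexVertex) (L L' : List HexVertex) :
    lw a b σ (L ++ [y] ++ z :: L') = lw a s(y, z) σ (L ++ [y]) * lw s(y, z) b σ (z :: L') := by
  have h1 := winding_append_cons_cons (hexMidpoint a :: L.map hexCenter) (hexCenter y)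
    (hexCenter z) (L'.map hexCenter ++ [hexMidpoint b])
  have h2 := winding_concat_right_ray (t := 1 / 2) (by norm_num)
    (hexMidpoint a :: L.map hexCenter) (hexCenter y) (hexCenter z)
  have h3 := winding_cons_left_ray (t := 1 / 2) (by norm_num) (hexCenter y) (hexCenter z)
    (L'.map hexCenter ++ [hexMidpoint b])
  have hm : hexMidpoint s(y, z) = hexCenter y + (1 / 2 : ℝ) * (hexCenter z - hexCenter y) := by
    rw [hexMidpoint_mk]; push_cast; ring
  have hm' : hexMidpoint s(y, z) = hexCenter z + (1 / 2 : ℝ) * (hexCenter y - hexCenter z) := by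
    rw [hexMidpoint_mk]; push_cast; ring
  have hW : Literature.Probability.LatticeModels.winding
      (hexMidpoint a :: (L ++ [y] ++ z :: L').map hexCenter ++ [hexMidpoint b]) =
      Literature.Probability.LatticeModels.winding
        (hexMidpoint a :: (L ++ [y]).map hexCenter ++ [hexMidpoint s(y, z)]) +
      Literature.Probability.LatticeModels.winding
        (hexMidpoint s(y, z) :: (z :: L').map hexCenter ++ [hexMidpoint b]) := by
    rw [← hm] at h2
    rw [← hm'] at h3
    simp only [List.map_append, List.map_cons, List.map_nil, List.cons_append, List.append_assoc,
      List.nil_append] at h1 h2 h3 ⊢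
    rw [h1, h2, h3]
  simp only [lw, hW, List.length_append, List.length_cons, pow_add,
    Complex.ofReal_add, mul_add, Complex.exp_add]
  ring

/-- The weighted, `E`-restricted star sum with coefficients `c` and list weights `F`. [folklore] -/
theorem star_sdiff_eq {y z : HexVertex} {π : HexMidEdgeSAW D a s(y, z)} (hP : IsPrefix v ρ y z π)
    (hρ : 1 ≤ ρ) : star (D \ π.verts.toFinset) v = star D v := by
  ext t
  simp only [star, Finset.mem_filter, Finset.mem_sdiff, List.mem_toFinset]
  constructor
  · rintro ⟨⟨hD, -⟩, hadj⟩; exact ⟨hD, hadj⟩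
  · rintro ⟨hD, hadj⟩
    refine ⟨⟨hD, fun hmem => ?_⟩, hadj⟩
    have h1 := ((isPrefix_iff π).1 hP).2.2.2 t hmem
    have h2 := dist_hexCenter_le_one_of_adj hadj
    rw [dist_comm] at h2
    linarith

/-- **Renewal of restricted star sums** (both the complex defect-type sums and the real
mass-type sums): with multiplicative list weights `F`, the `E`-restricted star sum of `D` from
`s(u,w)` re-sums over first-entrance prefixes `π` into `B(v,ρ)` (`ρ ≥ 1`) as
`F(π) ·` (the restricted star sum of the slit domain `D ∖ π` from the entrance mid-edge).
[folklore] -/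
theorem star_sum_renewal {R : Type*} [CommSemiring R] (hu : u ∉ D)
    (hw : ρ < dist (hexCenter w) (hexCenter v)) (hρ : 1 ≤ ρ)
    (F : Sym2 HexVertex → Sym2 HexVertex → List HexVertex → R)
    (hF : ∀ (a b : Sym2 HexVertex) (y z : HexVertex) (L L' : List HexVertex),
      F a b (L ++ [y] ++ z :: L') = F a s(y, z) (L ++ [y]) * F s(y, z) b (z :: L'))
    (c : HexVertex → R) (E : List HexVertex → Prop) :
    ∑ t ∈ star D v, c t * ∑ ω : HexMidEdgeSAW D s(u, w) s(v, t),
        (if E ω.verts then F s(u, w) s(v, t) ω.verts else 0) =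
      ∑ p ∈ D ×ˢ D, ∑ π : HexMidEdgeSAW D s(u, w) s(p.1, p.2),
        if IsPrefix v ρ p.1 p.2 π then F s(u, w) s(p.1, p.2) π.verts *
          ∑ t ∈ star (D \ π.verts.toFinset) v, c t *
            ∑ ω' : HexMidEdgeSAW (D \ π.verts.toFinset) s(p.1, p.2) s(v, t),
              (if E (π.verts ++ ω'.verts) then F s(p.1, p.2) s(v, t) ω'.verts else 0)
        else 0 := by
  have hst : ∀ t ∈ star D v, dist (hexCenter t) (hexCenter v) ≤ ρ := fun t ht => by
    have h := (Finset.mem_filter.1 ht).2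
    rw [dist_comm]; exact (dist_hexCenter_le_one_of_adj h).trans hρ
  have hρ0 : (0 : ℝ) ≤ ρ := zero_le_one.trans hρ
  rw [Finset.sum_congr rfl fun t ht => by
    rw [sum_walks_eq_sum_prefix hu hw (hst t ht) hρ0
      (fun l => if E l then F s(u, w) s(v, t) l else 0)]]
  simp_rw [Finset.mul_sum]
  rw [Finset.sum_comm]
  refine Finset.sum_congr rfl fun p _ => ?_
  rw [Finset.sum_comm]
  refine Finset.sum_congr rfl fun π _ => ?_
  by_cases hP : IsPrefix v ρ p.1 p.2 π
  · simp only [if_pos hP]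
    rw [star_sdiff_eq hP hρ]
    refine Finset.sum_congr rfl fun t ht => ?_
    rw [Finset.mul_sum]
    refine Finset.sum_congr rfl fun ω' _ => ?_
    have hz := head_eq_of_isPrefix hP (hst t ht) hρ0 ω'
    have hπ : π.verts = π.verts.dropLast ++ [p.1] := (List.dropLast_append_getLast? _ hP.1).symm
    have hω : ω'.verts = p.2 :: ω'.verts.tail := List.eq_cons_of_mem_head? hz
    have hsplit : F s(u, w) s(v, t) (π.verts ++ ω'.verts) =
        F s(u, w) s(p.1, p.2) π.verts * F s(p.1, p.2) s(v, t) ω'.verts := by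
      have key := hF s(u, w) s(v, t) p.1 p.2 π.verts.dropLast ω'.verts.tail
      rw [← hπ, ← hω] at key
      exact key
    split_ifs <;> simp only [hsplit, mul_zero]; ring
  · simp only [if_neg hP, mul_zero, Finset.sum_const_zero]

/-- The `E`-restricted DEFECT-type star sum of `D` from the root mid-edge `a`:
`Σ_{t ∼ v} conj(mid{v,t} - c_v) Σ_{ω : a → {v,t}, E ω} e^{-5iW/8} x_c^ℓ`. [folklore] -/
def TC (D : Finset HexVertex) (a : Sym2 HexVertex) (v : HexVertex) (E : List HexVertex → Prop) :
    ℂ :=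
  ∑ t ∈ star D v, (starRingEnd ℂ) (hexMidpoint s(v, t) - hexCenter v) *
    ∑ ω : HexMidEdgeSAW D a s(v, t), if E ω.verts then ω.weight xc (5 / 8) else 0

/-- The `E`-restricted MASS-type star sum `Σ_{t ∼ v} Σ_{ω : a → {v,t}, E ω} x_c^ℓ`. [folklore] -/
def TR (D : Finset HexVertex) (a : Sym2 HexVertex) (v : HexVertex) (E : List HexVertex → Prop) :
    ℝ :=
  ∑ t ∈ star D v, ∑ ω : HexMidEdgeSAW D a s(v, t), if E ω.verts then xc ^ ω.length else 0

/-- The defect is the unrestricted `TC`. [folklore] -/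
theorem defect_eq_TC (D : Finset HexVertex) (y z v : HexVertex) :
    defect D y z v = TC D s(y, z) v fun _ => True := by
  simp [defect, TC, hexParafermionicObservable]

/-- The mass is the unrestricted `TR`. [folklore] -/
theorem mass_eq_TR (D : Finset HexVertex) (y z v : HexVertex) :
    mass D y z v = TR D s(y, z) v fun _ => True := by
  simp only [mass, TR, if_true]
  refine Finset.sum_congr rfl fun t _ => ?_
  rw [hexParafermionicObservable_zero_spin, Complex.norm_real,
    Real.norm_of_nonneg (Finset.sum_nonneg fun γ _ => pow_nonneg hexCriticalFugacity_pos_lt_one.1.le _)]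

/-- The exit mass is the `TR` restricted to walks visiting distance `> L`. [folklore] -/
theorem exitMass_eq_TR (D : Finset HexVertex) (y z v : HexVertex) (L : ℝ) :
    exitMass D y z v L =
      TR D s(y, z) v fun l => ∃ q ∈ l, L < dist (hexCenter q) (hexCenter v) := by
  simp only [exitMass, TR]
  refine Finset.sum_congr rfl fun t _ => Finset.sum_congr rfl fun ω _ => ?_
  split_ifs <;> rfl

/-- **Renewal of the restricted defect-type sums.** [folklore] -/
theorem TC_renewal (hu : u ∉ D) (hw : ρ < dist (hexCenter w) (hexCenter v)) (hρ : 1 ≤ ρ)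
    (E : List HexVertex → Prop) :
    TC D s(u, w) v E = ∑ p ∈ D ×ˢ D, ∑ π : HexMidEdgeSAW D s(u, w) s(p.1, p.2),
      if IsPrefix v ρ p.1 p.2 π then π.weight xc (5 / 8) *
        TC (D \ π.verts.toFinset) s(p.1, p.2) v (fun l => E (π.verts ++ l)) else 0 := by
  have h := star_sum_renewal hu hw hρ (fun a b l => lw a b (5 / 8) l)
    (fun a b y z L L' => lw_append a b _ y z L L')
    (fun t => (starRingEnd ℂ) (hexMidpoint s(v, t) - hexCenter v)) E
  simp only [TC, weight_eq_lw]
  exact h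

/-- **Renewal of the restricted mass-type sums.** [folklore] -/
theorem TR_renewal (hu : u ∉ D) (hw : ρ < dist (hexCenter w) (hexCenter v)) (hρ : 1 ≤ ρ)
    (E : List HexVertex → Prop) :
    TR D s(u, w) v E = ∑ p ∈ D ×ˢ D, ∑ π : HexMidEdgeSAW D s(u, w) s(p.1, p.2),
      if IsPrefix v ρ p.1 p.2 π then xc ^ π.length *
        TR (D \ π.verts.toFinset) s(p.1, p.2) v (fun l => E (π.verts ++ l)) else 0 := by
  have h := star_sum_renewal hu hw hρ (fun _ _ l => xc ^ l.length)
    (fun a b y z L L' => by simp only [List.length_append, List.length_cons, pow_add])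
    (fun _ => (1 : ℝ)) E
  simp only [one_mul] at h
  simp only [TR, HexMidEdgeSAW.length]
  exact h

/-- **FIRST-ENTRANCE RENEWAL OF THE DEFECT** (registered helper `tm_defect_renewal`): for
`u ∉ Λ`, `r ≥ 1` and `w` outside `B(v,r)`, the vertex-star defect `T(Λ,u,w,v)` is the sum over
the first-entrance prefixes `π : s(u,w) → s(y,z)` into `B(v,r)` of
`e^{-5iW(π)/8} x_c^{|π|} · T(Λ ∖ π, y, z, v)` (windings add, weights multiply). [folklore] -/
theorem tm_defect_renewal : ∀ (Λ : Finset HexVertex) (u w v : HexVertex) (r : ℝ), u ∉ Λ →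
    1 ≤ r → r < dist (hexCenter w) (hexCenter v) →
      defect Λ u w v = prefixSumC Λ u w v r
        (fun y z π => π.weight xc (5 / 8) * defect (Λ \ π.verts.toFinset) y z v) := by
  intro Λ u w v r hu hr hw
  rw [defect_eq_TC, TC_renewal hu hw hr, prefixSumC]
  refine Finset.sum_congr rfl fun p _ => Finset.sum_congr rfl fun π _ => ?_
  rw [defect_eq_TC]

/-- **FIRST-ENTRANCE RENEWAL OF THE MASS** (registered helper `tm_mass_renewal`):
`M(Λ,u,w,v) = Σ_π x_c^{|π|} M(Λ ∖ π, y, z, v)` over the first-entrance prefixes into `B(v,r)`.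
[folklore] -/
theorem tm_mass_renewal : ∀ (Λ : Finset HexVertex) (u w v : HexVertex) (r : ℝ), u ∉ Λ →
    1 ≤ r → r < dist (hexCenter w) (hexCenter v) →
      mass Λ u w v = prefixSumR Λ u w v r
        (fun y z π => xc ^ π.length * mass (Λ \ π.verts.toFinset) y z v) := by
  intro Λ u w v r hu hr hw
  rw [mass_eq_TR, TR_renewal hu hw hr, prefixSumR]
  refine Finset.sum_congr rfl fun p _ => Finset.sum_congr rfl fun π _ => ?_
  rw [mass_eq_TR]

end StarSums

section Rot3

variable (v : HexVertex)

/-- **`rot3 v` is the rotation by `+120°` about `c_v`**: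
`c(rot3 v y) - c_v = ζ² (c_y - c_v)` (`ζ = e^{iπ/3}`; uses `ζ² = ζ - 1`). [folklore] -/
theorem hexCenter_rot3_sub (y : HexVertex) :
    hexCenter (rot3 v y) - hexCenter v = triZeta ^ 2 * (hexCenter y - hexCenter v) := by
  obtain ⟨x, k⟩ := y
  obtain ⟨p, j⟩ := v
  have hsmul : ∀ (n : ℤ) (q : Site 2), triEmbed (n • q) = (n : ℂ) * triEmbed q := fun n q => by
    simp only [triEmbed, Pi.smul_apply, smul_eq_mul, Int.cast_mul]; ring
  simp only [rot3, hexCenter, triEmbed_add, triEmbed_sub, hsmul,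
    triEmbed_triRot60_holds (triRot60 _), triEmbed_triRot60_holds (x - p), triEmbed_single_zero]
  push_cast
  linear_combination (((j : ℕ) : ℂ) - ((k : ℕ) : ℂ)) / 3 * (triZeta + 2) * triZeta_sq

/-- `rot3 v` fixes `v`. [folklore] -/
theorem rot3_self : rot3 v v = v := by
  obtain ⟨p, j⟩ := v
  refine Prod.ext ?_ rfl
  funext i
  fin_cases i <;> simp [rot3, triRot60] <;> rfl

/-- `rot3 v` has order `3`. [folklore] -/
theorem rot3_rot3_rot3 (y : HexVertex) : rot3 v (rot3 v (rot3 v y)) = y := by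
  obtain ⟨x, k⟩ := y
  obtain ⟨p, j⟩ := v
  refine Prod.ext ?_ rfl
  funext i
  fin_cases i <;> simp [rot3, triRot60] <;> ring

/-- `‖ζ²‖ = 1`. [folklore] -/
theorem norm_triZeta_sq : ‖triZeta ^ 2‖ = 1 := by
  rw [norm_pow, ← Real.sqrt_sq (norm_nonneg triZeta), Complex.sq_norm, normSq_triZeta]
  simp

/-- `rot3 v` is an isometry for distances to `c_v`… [folklore] -/
theorem dist_rot3 (y : HexVertex) :
    dist (hexCenter (rot3 v y)) (hexCenter v) = dist (hexCenter y) (hexCenter v) := by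
  rw [Complex.dist_eq, Complex.dist_eq, hexCenter_rot3_sub, norm_mul, norm_triZeta_sq, one_mul]

/-- … and an isometry of the embedded lattice. [folklore] -/
theorem dist_rot3_rot3 (y y' : HexVertex) :
    dist (hexCenter (rot3 v y)) (hexCenter (rot3 v y')) = dist (hexCenter y) (hexCenter y') := by
  rw [Complex.dist_eq, Complex.dist_eq,
    show hexCenter (rot3 v y) - hexCenter (rot3 v y') = (hexCenter (rot3 v y) - hexCenter v) -
      (hexCenter (rot3 v y') - hexCenter v) by ring, hexCenter_rot3_sub, hexCenter_rot3_sub,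
    ← mul_sub, norm_mul, norm_triZeta_sq, one_mul]
  congr 1; ring

/-- Adjacency at the origin cell is invariant under the linear part of `rot3`. [folklore] -/
theorem adj_zero_iff_rot (k k' : Fin 2) (d : Site 2) :
    hexGraph.Adj ((0 : Site 2), k) (d, k') ↔
      hexGraph.Adj ((0 : Site 2), k)
        (triRot60 (triRot60 d) + (((k : ℕ) : ℤ) - ((k' : ℕ) : ℤ)) • Pi.single 0 1, k') := by
  have key : ∀ c c' : Site 2, c = c' ↔ c 0 = c' 0 ∧ c 1 = c' 1 := fun c c' =>
    ⟨fun h => by simp [h], fun h => funext fun i => by fin_cases i <;> simp [h.1, h.2]⟩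
  fin_cases k <;> fin_cases k'
  · exact iff_of_false (not_hexGraph_adj_of_snd_eq_holds _ _ rfl)
      (not_hexGraph_adj_of_snd_eq_holds _ _ rfl)
  · simp only [Fin.zero_eta, Fin.mk_one]
    rw [hexGraph_adj_iff_of_snd_eq_zero_holds, hexGraph_adj_iff_of_snd_eq_zero_holds]
    simp only [key, triRot60]
    simp
    omega
  · simp only [Fin.zero_eta, Fin.mk_one]
    rw [hexGraph_adj_iff_of_snd_eq_one, hexGraph_adj_iff_of_snd_eq_one]
    simp only [key, triRot60]
    simp
    omega
  · exact iff_of_false (not_hexGraph_adj_of_snd_eq_holds _ _ rfl)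
      (not_hexGraph_adj_of_snd_eq_holds _ _ rfl)

/-- **`rot3 v` is an automorphism of the honeycomb lattice.** [folklore] -/
theorem rot3_adj_iff (y y' : HexVertex) :
    hexGraph.Adj (rot3 v y) (rot3 v y') ↔ hexGraph.Adj y y' := by
  obtain ⟨x, k⟩ := y
  obtain ⟨x', k'⟩ := y'
  obtain ⟨p, j⟩ := v
  simp only [rot3]
  rw [hexGraph_adj_iff_sub, hexGraph_adj_iff_sub x x' k k']
  have e : p + triRot60 (triRot60 (x' - p)) + (((j : ℕ) : ℤ) - ((k' : ℕ) : ℤ)) • Pi.single 0 1 -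
      (p + triRot60 (triRot60 (x - p)) + (((j : ℕ) : ℤ) - ((k : ℕ) : ℤ)) • Pi.single 0 1) =
      triRot60 (triRot60 (x' - x)) + (((k : ℕ) : ℤ) - ((k' : ℕ) : ℤ)) • Pi.single 0 1 := by
    funext i
    fin_cases i <;>
      simp only [triRot60, Pi.add_apply, Pi.sub_apply, Pi.smul_apply, smul_eq_mul,
        Matrix.cons_val_zero, Matrix.cons_val_one, Pi.single_apply, Fin.zero_eta, Fin.mk_one] <;>
      simp <;> ring
  rw [e]
  exact (adj_zero_iff_rot k k' (x' - x)).symm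

/-- `rot3 v` as a graph automorphism of `hexGraph`. [folklore] -/
def rot3Iso : hexGraph ≃g hexGraph where
  toEquiv :=
    { toFun := rot3 v
      invFun := fun y => rot3 v (rot3 v y)
      left_inv := fun y => rot3_rot3_rot3 v y
      right_inv := fun y => by
        show rot3 v (rot3 v (rot3 v y)) = y
        exact rot3_rot3_rot3 v y }
  map_rel_iff' := rot3_adj_iff v _ _

/-- `rot3Iso v` is `rot3 v`. [folklore] -/
@[simp] theorem coe_rot3Iso : ⇑(rot3Iso v) = rot3 v := rfl

/-- `rot3 v` acts on centres by the affine map `z ↦ ζ² z + (1 - ζ²) c_v`. [folklore] -/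
theorem hexCenter_rot3 (y : HexVertex) :
    hexCenter (rot3 v y) = triZeta ^ 2 * hexCenter y + (1 - triZeta ^ 2) * hexCenter v := by
  have h := hexCenter_rot3_sub v y
  linear_combination h

end Rot3

end Summit.CriticalPhenomena.SAWScalingLimit.Theorems.DefectDecoherence.TipMartingale

end
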